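import Summits.PneNP.PneNP.Theorems.ChebyshevTracialDesignBlockStatisticPricingByType
import HarnessLib

/-!
# Cell pnp-psdrank, route `ChebyshevTracialDesign`: PER-MATCHING PRICING OF A BLOCK STATISTIC — ALL HYPOTHESES ON THE `H`-TYPE OF THE MATCHING
# (the atypical `α`-tail made uniform; crux `TracialDecayExp20`, stmt-PneNP-19878)

Brick 118c (prover g21; MEMO-24 §2b). Brick 118b (`designValue_blockStat_le_of_type_tail`) prices `ψ(|U∩H|)` at a matching `M` from the
`H`-type of `M` plus ONE arithmetic hypothesis `hμ`: the binomial-moment tail `C(s, s+1−r₀)·C(a, s+1−r₀)/C((n−4k)/2−c, s+1−r₀) ≤ μ` for all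
orders `1 ≤ k ≤ D+1`, levels `c + 2 ≤ T` and `c + 2s + 2k = t` (`a` = number of `HH` edges of `M`; lit g32's `atypical_sum_le`). Here that
tail is bounded UNIFORMLY: with `N_min = (n − 4(D+1))/2 − (T−2)`, `s_min = (t − T − 2D)/2` and `a ≤ N_min`, `r₀ ≤ s_min + 1`,
`C(s,s+1−r₀)·C(a,s+1−r₀)/C(N′,s+1−r₀) ≤ (t/2)^{r₀−1}·(a/N_min)^{s_min+1−r₀}` (`tail_le_pow`, `atypical_tail_le_uniform`:
`C(s, r₀−1) ≤ s^{r₀−1}`, `C(a,k′)/C(N′,k′) ≤ (a/N′)^{k′}` — lit's `choose_mul_pow_le` — and monotonicity in `s`, `N′`, `k′`), whence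
**`designValue_blockStat_le_of_type_uniform`**: the per-matching pricing of ANY block statistic by ANY exact design with hypotheses on the
`H`-type `(a, b, d)` of `M` ONLY (four `β`-margins, a variance floor `V₀ ≤ β⁴(b+d−4(D+1)−2T)`, `a ≤ N_min`, `1 ≤ r₀ ≤ s_min+1`), and
`X_k = (2√192·√(4k/V₀))^{2k} + 4^k·(t/2)^{r₀−1}·(a/N_min)^{s_min+1−r₀}`.
READING: for `|H| = n/2` and typical `M` (`a ≈ n/8`, `N_min ≈ n/2`): `a/N_min ≈ 1/4`, so with `r₀ = β(b+d) ≍ βn` the tail is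
`≈ (n/4)^{βn}·4^{−n/4}` — exponentially small once `β·log n < (log 4)/4·(s_min/n)`, i.e. `β ≍ 1/log n` (then `V₀ ≍ n/log⁴ n ≫ D`): every term of
`X_k` is explicit in `(n, t, T, D, a, b, d, β, r₀)`. WHAT THIS FILE DOES NOT DO: choose `β, r₀` and take `n → ∞` (that is the M-averaged
statement, with eng's `2^{−βN}` tails for the matchings violating the margins); tilted masks; anything on `TracialDecayExp20`, psd rank or P vs NP.
[cite: Rothvoss2017, §2 (PDF p. 6)] [cite: RollinRoss2010, §4.1 Thm 4.2] [cite: Agarwal2000DifferenceEquations, Remark 1.8.1 (1.8.8)] [cite: GriblingDelaatLaurent2019, §5]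
Stature: support/instrument (kernel lane, no defs, axioms standard). Supports stmt-PneNP-19878.
-/

set_option linter.dupNamespace false -- `Summit.PneNP.PneNP.…`: summit = sub-problem (D-0017)

noncomputable section

namespace Summit.PneNP.PneNP.Theorems.ChebyshevTracialDesignBlockStatisticPricingUniform

open Finset Polynomial Literature.Barriers.PneNP Literature.Combinatorics.Optimization
open Literature.Combinatorics.Optimization.ShellStep
open Literature.Combinatorics.StablePolynomials (choose_mul_pow_le)
open Summit.PneNP.PneNP.Theorems.ChebyshevTracialDesignBlockStatisticPricingByType (designValue_blockStat_le_of_type_tail three_le_top)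

variable {n : ℕ}

/-! ### §1 The binomial-moment tail is at most `s^{r₀−1}·(a/N′)^{s+1−r₀}` -/

/-- `C(a,k)/C(N,k) ≤ (a/N)^k` for `a ≤ N`, `0 < N` (each factor `(a−i)/(N−i) ≤ a/N`; lit's `choose_mul_pow_le`).
[cite: Rothvoss2017, §2 (PDF p. 5)] -/
theorem choose_div_choose_le_pow {a N k : ℕ} (haN : a ≤ N) (hN : 0 < N) :
    ((a.choose k : ℕ) : ℝ) / ((N.choose k : ℕ) : ℝ) ≤ ((a : ℝ) / N) ^ k := by
  by_cases hk : N.choose k = 0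
  · rw [hk, Nat.cast_zero, div_zero]; positivity
  have hpos : (0 : ℝ) < (N.choose k : ℕ) := by exact_mod_cast Nat.pos_of_ne_zero hk
  have h := choose_mul_pow_le a (N - a) k
  have e : ((a : ℝ) + ((N - a : ℕ) : ℝ)) = N := by rw [Nat.cast_sub haN]; ring
  rw [show a + (N - a) = N by omega, e] at h
  rw [div_le_iff₀ hpos, div_pow, div_mul_eq_mul_div, le_div_iff₀ (by positivity)]
  linarith

/-- **The tail is at most `s^{r₀−1}·(a/N′)^{s+1−r₀}`** (`1 ≤ r₀ ≤ s+1`, `a ≤ N′`, `0 < N′`).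
[cite: RollinRoss2010, §4.1 Thm 4.2] -/
theorem tail_le_pow {s a N' r₀ : ℕ} (hr₀ : 1 ≤ r₀) (hr₀s : r₀ ≤ s + 1) (haN : a ≤ N') (hN : 0 < N') :
    ((s.choose (s + 1 - r₀) : ℕ) : ℝ) * ((a.choose (s + 1 - r₀) : ℕ) : ℝ) / ((N'.choose (s + 1 - r₀) : ℕ) : ℝ) ≤
      (s : ℝ) ^ (r₀ - 1) * (((a : ℝ) / N') ^ (s + 1 - r₀)) := by
  have h1 : ((s.choose (s + 1 - r₀) : ℕ) : ℝ) ≤ (s : ℝ) ^ (r₀ - 1) := by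
    have e : s.choose (s + 1 - r₀) = s.choose (r₀ - 1) := by
      rw [show s + 1 - r₀ = s - (r₀ - 1) by omega, Nat.choose_symm (by omega)]
    rw [e]; exact_mod_cast Nat.choose_le_pow s (r₀ - 1)
  have h2 := choose_div_choose_le_pow (k := s + 1 - r₀) haN hN
  rw [mul_div_assoc]
  exact mul_le_mul h1 h2 (by positivity) (by positivity)

/-- **Uniform tail over the deleted ground sets.** With `N_min = (n − 4(D+1))/2 − (T−2)`, `s_min = (t − T − 2D)/2`, `a ≤ N_min`, `0 < N_min`,
`1 ≤ r₀ ≤ s_min + 1`: for every `1 ≤ k ≤ D+1`, `c + 2 ≤ T`, `c + 2s + 2k = t`,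
`C(s,s+1−r₀)·C(a,s+1−r₀)/C((n−4k)/2−c,s+1−r₀) ≤ (t/2)^{r₀−1}·(a/N_min)^{s_min+1−r₀}`. [cite: RollinRoss2010, §4.1 Thm 4.2] -/
theorem atypical_tail_le_uniform {t T D a r₀ : ℕ} (hr₀ : 1 ≤ r₀) (hr₀s : r₀ ≤ (t - T - 2 * D) / 2 + 1)
    (haN : a ≤ (n - 4 * (D + 1)) / 2 - (T - 2)) (hN : 0 < (n - 4 * (D + 1)) / 2 - (T - 2)) :
    ∀ k c s : ℕ, 1 ≤ k → k ≤ D + 1 → c + 2 ≤ T → c + 2 * s + 2 * k = t →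
      ((s.choose (s + 1 - r₀) : ℕ) : ℝ) * ((a.choose (s + 1 - r₀) : ℕ) : ℝ) /
          ((((n - 4 * k) / 2 - c).choose (s + 1 - r₀) : ℕ) : ℝ) ≤
        (((t / 2 : ℕ) : ℝ)) ^ (r₀ - 1) * (((a : ℝ) / (((n - 4 * (D + 1)) / 2 - (T - 2) : ℕ) : ℝ)) ^ ((t - T - 2 * D) / 2 + 1 - r₀)) := by
  intro k c s hk1 hkD hcT hcs
  have hsmin : (t - T - 2 * D) / 2 ≤ s := by omega
  have hsmax : s ≤ t / 2 := by omega
  have hNle : (n - 4 * (D + 1)) / 2 - (T - 2) ≤ (n - 4 * k) / 2 - c := by omega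
  have hN' : 0 < (n - 4 * k) / 2 - c := lt_of_lt_of_le hN hNle
  have haN' : a ≤ (n - 4 * k) / 2 - c := haN.trans hNle
  refine (tail_le_pow hr₀ (by omega) haN' hN').trans ?_
  have hq1 : (a : ℝ) / (((n - 4 * k) / 2 - c : ℕ) : ℝ) ≤ (a : ℝ) / (((n - 4 * (D + 1)) / 2 - (T - 2) : ℕ) : ℝ) := by
    refine div_le_div_of_nonneg_left (by positivity) (by exact_mod_cast hN) (by exact_mod_cast hNle)
  have hq2 : (a : ℝ) / (((n - 4 * (D + 1)) / 2 - (T - 2) : ℕ) : ℝ) ≤ 1 := by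
    rw [div_le_one (by exact_mod_cast hN)]; exact_mod_cast haN
  have hq0 : (0 : ℝ) ≤ (a : ℝ) / (((n - 4 * k) / 2 - c : ℕ) : ℝ) := by positivity
  refine mul_le_mul ?_ ?_ (by positivity) (by positivity)
  · exact pow_le_pow_left₀ (by positivity) (by exact_mod_cast hsmax) _
  · calc ((a : ℝ) / (((n - 4 * k) / 2 - c : ℕ) : ℝ)) ^ (s + 1 - r₀)
        ≤ ((a : ℝ) / (((n - 4 * (D + 1)) / 2 - (T - 2) : ℕ) : ℝ)) ^ (s + 1 - r₀) := pow_le_pow_left₀ hq0 hq1 _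
      _ ≤ ((a : ℝ) / (((n - 4 * (D + 1)) / 2 - (T - 2) : ℕ) : ℝ)) ^ ((t - T - 2 * D) / 2 + 1 - r₀) :=
          pow_le_pow_of_le_one (by positivity) hq2 (by omega)

/-! ### §2 The pricing with hypotheses on the type of the matching only -/

/-- **PER-MATCHING PRICING OF A BLOCK STATISTIC — HYPOTHESES ON THE `H`-TYPE OF `M` ONLY (brick 118c).** For an exact design
`(n, t = t′+2(D+1), T, D, B_v, C, w)`, ANY block `H`, ANY profile `|ψ| ≤ G` on `[0,t]`, `m ≥ 3` with `m + 4(D+1) ≤ n`, and a matching `M` whose `H`-type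
(`a` `HH` edges, `b` mixed edges, `d` `H̄H̄` edges) satisfies `β(b+d)+T+2(D+1) ≤ min(b,d)`, `β(b+d) ≤ r₀`, `t/2+β(b+d)+2T+4(D+1) ≤ b+d`,
`0 < V₀ ≤ β⁴(b+d−4(D+1)−2T)`, `2(D+1)−1 ≤ 2V₀`, `a ≤ N_min`, `0 < N_min`, `1 ≤ r₀ ≤ s_min+1` (`N_min = (n−4(D+1))/2−(T−2)`, `s_min = (t−T−2D)/2`):
`|PM|·Σ_U W(U,M)·ψ(|U∩H|) ≤ −E_{Shell_1(M)}[ψ(|U∩H|)] + G·Σ_{k=1}^{D}(C(2k,k)/4^k)·ρ^k·X_k + B_v·C((T−1)/2,D+1)·G·ρ^{D+1}·X_{D+1}`,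
`X_k = (2√192·√(4k/V₀))^{2k} + 4^k·(t/2)^{r₀−1}·(a/N_min)^{s_min+1−r₀}`, `ρ = m/(4(m−2))`.
[cite: Rothvoss2017, §2 (PDF p. 6)] [cite: RollinRoss2010, §4.1 Thm 4.2] [cite: Agarwal2000DifferenceEquations, Remark 1.8.1 (1.8.8)]
[cite: GriblingDelaatLaurent2019, §5] -/
theorem designValue_blockStat_le_of_type_uniform {t' T D : ℕ} {Bv : ℝ} {C : Finset ℕ} {w : ℕ → ℝ}
    (hdes : IsExactDesign n (t' + 2 * (D + 1)) T D Bv C w) (M : PMatch n) (H : Finset (Fin n)) (ψ : ℤ → ℝ)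
    {G : ℝ} (hG0 : 0 ≤ G) (hG : ∀ x ∈ Icc (0 : ℤ) ((t' + 2 * (D + 1) : ℕ) : ℤ), |ψ x| ≤ G)
    {m : ℕ} (hm : 3 ≤ m) (hmn : m + 4 * (D + 1) ≤ n) {β V₀ : ℝ} (hβ : 0 < β) (hV₀ : 0 < V₀)
    {r₀ : ℕ} (hr₀1 : 1 ≤ r₀) (hr₀s : r₀ ≤ (t' + 2 * (D + 1) - T - 2 * D) / 2 + 1) (hkV : (2 * (D + 1 : ℕ) : ℝ) - 1 ≤ 2 * V₀)
    (haN : (reps M.2.partner (vAA M.2.partner univ H)).card ≤ (n - 4 * (D + 1)) / 2 - (T - 2))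
    (hN : 0 < (n - 4 * (D + 1)) / 2 - (T - 2))
    (hbT : β * (((reps M.2.partner (vBH M.2.partner univ H ∪ vBN M.2.partner univ H)).card : ℝ) +
      (reps M.2.partner (vDD M.2.partner univ H)).card) + T + 2 * (D + 1) ≤
      (reps M.2.partner (vBH M.2.partner univ H ∪ vBN M.2.partner univ H)).card)
    (hdT : β * (((reps M.2.partner (vBH M.2.partner univ H ∪ vBN M.2.partner univ H)).card : ℝ) +
      (reps M.2.partner (vDD M.2.partner univ H)).card) + T + 2 * (D + 1) ≤
      (reps M.2.partner (vDD M.2.partner univ H)).card)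
    (hr₀ : β * (((reps M.2.partner (vBH M.2.partner univ H ∪ vBN M.2.partner univ H)).card : ℝ) +
      (reps M.2.partner (vDD M.2.partner univ H)).card) ≤ r₀)
    (hsT : ((t' + 2 * (D + 1) : ℕ) : ℝ) / 2 +
      β * (((reps M.2.partner (vBH M.2.partner univ H ∪ vBN M.2.partner univ H)).card : ℝ) +
        (reps M.2.partner (vDD M.2.partner univ H)).card) + 2 * T + 4 * (D + 1) ≤
      ((reps M.2.partner (vBH M.2.partner univ H ∪ vBN M.2.partner univ H)).card : ℝ) +
        (reps M.2.partner (vDD M.2.partner univ H)).card)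
    (hV₀le : V₀ ≤ β ^ 4 * ((((reps M.2.partner (vBH M.2.partner univ H ∪ vBN M.2.partner univ H)).card : ℝ) +
      (reps M.2.partner (vDD M.2.partner univ H)).card) - 4 * (D + 1) - 2 * T)) :
    (Fintype.card (PMatch n) : ℝ) * ∑ U : OddSet n, levelWeight n (t' + 2 * (D + 1)) C w U M * ψ ((U.1 ∩ H).card : ℤ) ≤
      -((∑ U' ∈ shell M.2.partner (t' + 2 * (D + 1)) 1, ψ ((U' ∩ H).card : ℤ)) /
          ((shell M.2.partner (t' + 2 * (D + 1)) 1).card : ℝ)) +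
        G * ∑ k ∈ Icc 1 D, (((2 * k).choose k : ℕ) : ℝ) / (4 : ℝ) ^ k *
          ((((m : ℝ) / (4 * ((m : ℝ) - 2))) ^ k) *
            ((2 * Real.sqrt 192 * Real.sqrt (4 * k / V₀)) ^ (2 * k) + (4 : ℝ) ^ k * ((((t' + 2 * (D + 1)) / 2 : ℕ) : ℝ) ^ (r₀ - 1) * (((reps M.2.partner (vAA M.2.partner univ H)).card : ℝ) / (((n - 4 * (D + 1)) / 2 - (T - 2) : ℕ) : ℝ)) ^ ((t' + 2 * (D + 1) - T - 2 * D) / 2 + 1 - r₀)))) +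
        Bv * ((((T - 1) / 2).choose (D + 1) : ℕ) : ℝ) *
          (G * (((m : ℝ) / (4 * ((m : ℝ) - 2))) ^ (D + 1) *
            ((2 * Real.sqrt 192 * Real.sqrt (4 * (D + 1 : ℕ) / V₀)) ^ (2 * (D + 1 : ℕ)) + (4 : ℝ) ^ (D + 1 : ℕ) * ((((t' + 2 * (D + 1)) / 2 : ℕ) : ℝ) ^ (r₀ - 1) * (((reps M.2.partner (vAA M.2.partner univ H)).card : ℝ) / (((n - 4 * (D + 1)) / 2 - (T - 2) : ℕ) : ℝ)) ^ ((t' + 2 * (D + 1) - T - 2 * D) / 2 + 1 - r₀))))) :=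
  designValue_blockStat_le_of_type_tail hdes M H ψ hG0 hG hm hmn hβ hV₀ (by positivity) hr₀1 hkV hbT hdT hr₀ hsT hV₀le
    (atypical_tail_le_uniform hr₀1 hr₀s haN hN)

end Summit.PneNP.PneNP.Theorems.ChebyshevTracialDesignBlockStatisticPricingUniform

end
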